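import Literature.Algebra.Polynomial.CasasAlvero.Char419Digits
import Literature.Algebra.Polynomial.CasasAlvero.Char419DigitsHigh
import Literature.Algebra.Polynomial.CasasAlvero.Char419DigitsTop
import Literature.Algebra.Polynomial.CasasAlvero.Pentanomial
import Literature.Algebra.Polynomial.CasasAlvero.Degree6CandidatesPrime
import Literature.Algebra.Polynomial.CasasAlvero.FieldCorollaries
import Literature.Algebra.Polynomial.CasasAlvero.Degree5
import Literature.Algebra.Polynomial.CasasAlvero.Degree6
import Literature.Algebra.Polynomial.CasasAlvero.DigitReduction
import HarnessLib

/-!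
# Casas-Alvero degrees in characteristic 419: the classification away from the digit `8`

Over EVERY field `K` of characteristic `419` and for every degree `d` that is NOT of the form `8·419^k`:
`CA_d(K) ⟺ d = 0 ∨ d = a·419^k` with `1 ≤ a ≤ 6`.  The one digit left open is `a = 8`, for the following reason.  Every bad digit in this
tree is refuted by an explicit `𝔽_p`-rational sparse polynomial with `𝔽_p`-rational witnesses (which lives in every field of characteristic `p`), but the
EXHAUSTIVE search of the translated–scaled normal form `X^8 + a_6 X^6 + … + a_1 X` over `𝔽_419`, in two independent implementations (`cls/dfbundle/dfind.py 419:8`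
and `cls/dfb/dfind_b.py 419:8`; kit jobs j131970 (`dfind_b.py`) and j131639 (`dfind.py`)), returns NOTHING: there is no Casas-Alvero octic over `𝔽_419` all of whose Hasse-derivative witnesses lie in
`𝔽_419`.  Consequently `CA_8` cannot be refuted uniformly over all fields of characteristic `419` by this method (indeed the search says that `CA_8` holds over
the prime field `𝔽_419` itself — a computational statement NOT formalised here), and whether `CA_8` holds over the algebraic closure of `𝔽_419` (whether `419`
is a good prime of degree `8` in the sense of [CastryckLaterveerOunaies2012]) is not decided in this tree: the cell has kernel-checked certificate machinery
for the degrees `≤ 7` only.  (COMPUTED BUT NOT FORMALISED: two independent implementations of the cell's scenario method made generic in the degree — implementation A,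
`d8/certD.py`, kit job j132786 (types ≤ 4) with j132845 (types 5, 6): for every one of the `876` non-trivial witness-coincidence scenarios of degree `8` an explicit Nullstellensatz certificate
`r_i^k = Σ_j g_j E_j (mod 419)`, found by linear algebra and RE-VERIFIED by polynomial multiplication over `ℤ`; implementation B, `d8/implB_groebnerd.py` (sympy Gröbner
bases over `GF(419)`), kit job j132279: every scenario inconsistent — agree that `419` is a GOOD prime for degree `8`, i.e. that `CA_8` holds over every field of
characteristic `419` and the digit set of characteristic `419` is `{1, 2, 3, 4, 5, 6, 8}`.  Nothing of this is kernel-checked: the theorem needs the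
degree-`8` analogue of `Degree7ScenariosClosed.lean` plus the certificate data as Lean files, which is left open here; until then this file carves the digit out.)  Nothing below depends on the outcome.
Ingredients: the digit reduction `CA_d ⇒ d = a·p^k ∧ CA_a` (`DigitReduction.lean`, any field); the positive digits `1, 2, 3, 4`
([GrafVonBothmerEtAl2007, Props. 2, 6]), `5` (`Degree5.lean`: `419` is not one of the nine bad primes of degree `5`), `6` (`419` is not among the `54`
candidate bad primes of degree `6` of `Degree6CandidatesPrime.lean`, so `CA_6` holds in characteristic `419` [CastryckLaterveerOunaies2012, Thm. 4]) (while `7` is BAD: the sparse `𝔽_419`-septic `not_holdsInDegree_seven_of_char_419` of `Char419Digits.lean`; the degree-`7` table of `BadDegrees.lean` stops at `61`);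
and a refutation of every digit `7 ≤ a ≤ 418`, `a ≠ 8`, over every field of characteristic `419`: `7` as said;
`20, 43, 63, 93, 95, 96, 105, 107, 114, 118, 127, 134, 135, 141, 143, 156, 161, 170, 171, 172, 173, 181, 183, 192, 205, 207, 215, 216, 217, 226, 232, 239, 241, 242, 247, 255, 263, 268, 274, 277, 278, 289, 292, 293, 295, 299, 301, 307, 310, 313, 315, 321, 323, 325, 335, 340, 344, 345, 347, 352, 356, 357, 362, 363, 365, 371, 373, 377, 379, 381, 383, 385, 389, 392, 395, 398, 401, 402, 405, 412, 413, 415, 418` by the binomial criterion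
(`m = 5, 10, 17, 46, 24, 3, 5, 23, 57, 56, 54, 57, 13, 44, 61, 6, 50, 9, 68, 29, 39, 41, 6, 43, 82, 53, 37, 77, 62, 29, 55, 76, 6, 79, 41, 76, 62, 6, 129, 35, 33, 47, 13, 56, 82, 83, 105, 50, 85, 117, 68, 44, 3, 148, 119, 9, 19, 54, 24, 173, 56, 82, 62, 45, 154, 46, 55, 140, 134, 178, 141, 10, 17, 141, 84, 13, 29, 65, 122, 150, 100, 95, 2`); and the 327 remaining digits by the sparse `𝔽_419`-examples of `Char419Digits.lean`, `Char419DigitsHigh.lean` and `Char419DigitsTop.lean`.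
-/

noncomputable section

open Polynomial

set_option maxRecDepth 8192

namespace Literature.Algebra.Polynomial.CasasAlvero

section CharFourHundredNineteenPartial

variable (K : Type*) [Field K] [CharP K 419]

/-- `CA_{6·419^k}` over every field of characteristic `419` (`CA_6` itself — the case `k = 0` — holds because `419` is not among the
`54` candidate bad primes of degree `6` of `Degree6CandidatesPrime.lean`, `holdsInDegree_six_of_not_mem`, i.e. `419` is a GOOD prime for degree `6`
[cite: CastryckLaterveerOunaies2012, Thm. 4]). [cite: GrafVonBothmerEtAl2007, Prop. 6] -/
theorem holdsInDegree_six_mul_pow_of_char_419' (k : ℕ) : HoldsInDegree K (6 * 419 ^ k) := by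
  haveI : Fact (Nat.Prime 419) := ⟨by norm_num⟩
  exact holdsInDegree_mul_prime_pow_field K 419 (holdsInDegree_six_of_not_mem (K := AlgebraicClosure K) 419 (by decide)) k

set_option maxHeartbeats 4000000 in
/-- every digit `7 ≤ a < 419` other than `8` fails: `¬ CA_a` over every field of characteristic `419` — the bad-prime computations of
[cite: CastryckLaterveerOunaies2012, Thm. 4] (degrees `≤ 7`) extended to these digits by explicit `𝔽_419`-rational examples and the
binomial criterion (the digit `8` has no `𝔽_419`-rational-witness example and is not treated). [cite: GrafVonBothmerEtAl2007, Prop. 6] -/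
theorem not_holdsInDegree_digit_of_char_fourHundredNineteen' {a : ℕ} (hlo : 7 ≤ a) (hap : a < 419) (h8 : a ≠ 8) : ¬ HoldsInDegree K a := by
  haveI : Fact (Nat.Prime 419) := ⟨by norm_num⟩
  interval_cases a
  · exact not_holdsInDegree_seven_of_char_419 K
  · exact absurd rfl h8
  · exact not_holdsInDegree_nine_of_char_419 K
  · exact not_holdsInDegree_ten_of_char_419 K
  · exact not_holdsInDegree_eleven_of_char_419 K
  · exact not_holdsInDegree_twelve_of_char_419 K
  · exact not_holdsInDegree_thirteen_of_char_419 K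
  · exact not_holdsInDegree_fourteen_of_char_419 K
  · exact not_holdsInDegree_fifteen_of_char_419 K
  · exact not_holdsInDegree_sixteen_of_char_419 K
  · exact not_holdsInDegree_seventeen_of_char_419 K
  · exact not_holdsInDegree_eighteen_of_char_419 K
  · exact not_holdsInDegree_nineteen_of_char_419 K
  · exact not_holdsInDegree_of_choose_modEq_one K 419 (d := 20) (m := 5) (by norm_num) (by norm_num) (by decide)
  · exact not_holdsInDegree_twentyOne_of_char_419 K
  · exact not_holdsInDegree_twentyTwo_of_char_419 K
  · exact not_holdsInDegree_twentyThree_of_char_419 K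
  · exact not_holdsInDegree_twentyFour_of_char_419 K
  · exact not_holdsInDegree_twentyFive_of_char_419 K
  · exact not_holdsInDegree_twentySix_of_char_419 K
  · exact not_holdsInDegree_twentySeven_of_char_419 K
  · exact not_holdsInDegree_twentyEight_of_char_419 K
  · exact not_holdsInDegree_twentyNine_of_char_419 K
  · exact not_holdsInDegree_thirty_of_char_419 K
  · exact not_holdsInDegree_thirtyOne_of_char_419 K
  · exact not_holdsInDegree_thirtyTwo_of_char_419 K
  · exact not_holdsInDegree_thirtyThree_of_char_419 K
  · exact not_holdsInDegree_thirtyFour_of_char_419 K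
  · exact not_holdsInDegree_thirtyFive_of_char_419 K
  · exact not_holdsInDegree_thirtySix_of_char_419 K
  · exact not_holdsInDegree_thirtySeven_of_char_419 K
  · exact not_holdsInDegree_thirtyEight_of_char_419 K
  · exact not_holdsInDegree_thirtyNine_of_char_419 K
  · exact not_holdsInDegree_forty_of_char_419 K
  · exact not_holdsInDegree_fortyOne_of_char_419 K
  · exact not_holdsInDegree_fortyTwo_of_char_419 K
  · exact not_holdsInDegree_of_choose_modEq_one K 419 (d := 43) (m := 10) (by norm_num) (by norm_num) (by decide)
  · exact not_holdsInDegree_fortyFour_of_char_419 K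
  · exact not_holdsInDegree_fortyFive_of_char_419 K
  · exact not_holdsInDegree_fortySix_of_char_419 K
  · exact not_holdsInDegree_fortySeven_of_char_419 K
  · exact not_holdsInDegree_fortyEight_of_char_419 K
  · exact not_holdsInDegree_fortyNine_of_char_419 K
  · exact not_holdsInDegree_fifty_of_char_419 K
  · exact not_holdsInDegree_fiftyOne_of_char_419 K
  · exact not_holdsInDegree_fiftyTwo_of_char_419 K
  · exact not_holdsInDegree_fiftyThree_of_char_419 K
  · exact not_holdsInDegree_fiftyFour_of_char_419 K
  · exact not_holdsInDegree_fiftyFive_of_char_419 K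
  · exact not_holdsInDegree_fiftySix_of_char_419 K
  · exact not_holdsInDegree_fiftySeven_of_char_419 K
  · exact not_holdsInDegree_fiftyEight_of_char_419 K
  · exact not_holdsInDegree_fiftyNine_of_char_419 K
  · exact not_holdsInDegree_sixty_of_char_419 K
  · exact not_holdsInDegree_sixtyOne_of_char_419 K
  · exact not_holdsInDegree_sixtyTwo_of_char_419 K
  · exact not_holdsInDegree_of_choose_modEq_one K 419 (d := 63) (m := 17) (by norm_num) (by norm_num) (by decide)
  · exact not_holdsInDegree_sixtyFour_of_char_419 K
  · exact not_holdsInDegree_sixtyFive_of_char_419 K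
  · exact not_holdsInDegree_sixtySix_of_char_419 K
  · exact not_holdsInDegree_sixtySeven_of_char_419 K
  · exact not_holdsInDegree_sixtyEight_of_char_419 K
  · exact not_holdsInDegree_sixtyNine_of_char_419 K
  · exact not_holdsInDegree_seventy_of_char_419 K
  · exact not_holdsInDegree_seventyOne_of_char_419 K
  · exact not_holdsInDegree_seventyTwo_of_char_419 K
  · exact not_holdsInDegree_seventyThree_of_char_419 K
  · exact not_holdsInDegree_seventyFour_of_char_419 K
  · exact not_holdsInDegree_seventyFive_of_char_419 K
  · exact not_holdsInDegree_seventySix_of_char_419 K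
  · exact not_holdsInDegree_seventySeven_of_char_419 K
  · exact not_holdsInDegree_seventyEight_of_char_419 K
  · exact not_holdsInDegree_seventyNine_of_char_419 K
  · exact not_holdsInDegree_eighty_of_char_419 K
  · exact not_holdsInDegree_eightyOne_of_char_419 K
  · exact not_holdsInDegree_eightyTwo_of_char_419 K
  · exact not_holdsInDegree_eightyThree_of_char_419 K
  · exact not_holdsInDegree_eightyFour_of_char_419 K
  · exact not_holdsInDegree_eightyFive_of_char_419 K
  · exact not_holdsInDegree_eightySix_of_char_419 K
  · exact not_holdsInDegree_eightySeven_of_char_419 K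
  · exact not_holdsInDegree_eightyEight_of_char_419 K
  · exact not_holdsInDegree_eightyNine_of_char_419 K
  · exact not_holdsInDegree_ninety_of_char_419 K
  · exact not_holdsInDegree_ninetyOne_of_char_419 K
  · exact not_holdsInDegree_ninetyTwo_of_char_419 K
  · exact not_holdsInDegree_of_choose_modEq_one K 419 (d := 93) (m := 46) (by norm_num) (by norm_num) (by decide)
  · exact not_holdsInDegree_ninetyFour_of_char_419 K
  · exact not_holdsInDegree_of_choose_modEq_one K 419 (d := 95) (m := 24) (by norm_num) (by norm_num) (by decide)
  · exact not_holdsInDegree_of_choose_modEq_one K 419 (d := 96) (m := 3) (by norm_num) (by norm_num) (by decide)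
  · exact not_holdsInDegree_ninetySeven_of_char_419 K
  · exact not_holdsInDegree_ninetyEight_of_char_419 K
  · exact not_holdsInDegree_ninetyNine_of_char_419 K
  · exact not_holdsInDegree_oneHundred_of_char_419 K
  · exact not_holdsInDegree_oneHundredOne_of_char_419 K
  · exact not_holdsInDegree_oneHundredTwo_of_char_419 K
  · exact not_holdsInDegree_oneHundredThree_of_char_419 K
  · exact not_holdsInDegree_oneHundredFour_of_char_419 K
  · exact not_holdsInDegree_of_choose_modEq_one K 419 (d := 105) (m := 5) (by norm_num) (by norm_num) (by decide)
  · exact not_holdsInDegree_oneHundredSix_of_char_419 K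
  · exact not_holdsInDegree_of_choose_modEq_one K 419 (d := 107) (m := 23) (by norm_num) (by norm_num) (by decide)
  · exact not_holdsInDegree_oneHundredEight_of_char_419 K
  · exact not_holdsInDegree_oneHundredNine_of_char_419 K
  · exact not_holdsInDegree_oneHundredTen_of_char_419 K
  · exact not_holdsInDegree_oneHundredEleven_of_char_419 K
  · exact not_holdsInDegree_oneHundredTwelve_of_char_419 K
  · exact not_holdsInDegree_oneHundredThirteen_of_char_419 K
  · exact not_holdsInDegree_of_choose_modEq_one K 419 (d := 114) (m := 57) (by norm_num) (by norm_num) (by decide)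
  · exact not_holdsInDegree_oneHundredFifteen_of_char_419 K
  · exact not_holdsInDegree_oneHundredSixteen_of_char_419 K
  · exact not_holdsInDegree_oneHundredSeventeen_of_char_419 K
  · exact not_holdsInDegree_of_choose_modEq_one K 419 (d := 118) (m := 56) (by norm_num) (by norm_num) (by decide)
  · exact not_holdsInDegree_oneHundredNineteen_of_char_419 K
  · exact not_holdsInDegree_oneHundredTwenty_of_char_419 K
  · exact not_holdsInDegree_oneHundredTwentyOne_of_char_419 K
  · exact not_holdsInDegree_oneHundredTwentyTwo_of_char_419 K
  · exact not_holdsInDegree_oneHundredTwentyThree_of_char_419 K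
  · exact not_holdsInDegree_oneHundredTwentyFour_of_char_419 K
  · exact not_holdsInDegree_oneHundredTwentyFive_of_char_419 K
  · exact not_holdsInDegree_oneHundredTwentySix_of_char_419 K
  · exact not_holdsInDegree_of_choose_modEq_one K 419 (d := 127) (m := 54) (by norm_num) (by norm_num) (by decide)
  · exact not_holdsInDegree_oneHundredTwentyEight_of_char_419 K
  · exact not_holdsInDegree_oneHundredTwentyNine_of_char_419 K
  · exact not_holdsInDegree_oneHundredThirty_of_char_419 K
  · exact not_holdsInDegree_oneHundredThirtyOne_of_char_419 K
  · exact not_holdsInDegree_oneHundredThirtyTwo_of_char_419 K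
  · exact not_holdsInDegree_oneHundredThirtyThree_of_char_419 K
  · exact not_holdsInDegree_of_choose_modEq_one K 419 (d := 134) (m := 57) (by norm_num) (by norm_num) (by decide)
  · exact not_holdsInDegree_of_choose_modEq_one K 419 (d := 135) (m := 13) (by norm_num) (by norm_num) (by decide)
  · exact not_holdsInDegree_oneHundredThirtySix_of_char_419 K
  · exact not_holdsInDegree_oneHundredThirtySeven_of_char_419 K
  · exact not_holdsInDegree_oneHundredThirtyEight_of_char_419 K
  · exact not_holdsInDegree_oneHundredThirtyNine_of_char_419 K
  · exact not_holdsInDegree_oneHundredForty_of_char_419 K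
  · exact not_holdsInDegree_of_choose_modEq_one K 419 (d := 141) (m := 44) (by norm_num) (by norm_num) (by decide)
  · exact not_holdsInDegree_oneHundredFortyTwo_of_char_419 K
  · exact not_holdsInDegree_of_choose_modEq_one K 419 (d := 143) (m := 61) (by norm_num) (by norm_num) (by decide)
  · exact not_holdsInDegree_oneHundredFortyFour_of_char_419 K
  · exact not_holdsInDegree_oneHundredFortyFive_of_char_419 K
  · exact not_holdsInDegree_oneHundredFortySix_of_char_419 K
  · exact not_holdsInDegree_oneHundredFortySeven_of_char_419 K
  · exact not_holdsInDegree_oneHundredFortyEight_of_char_419 K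
  · exact not_holdsInDegree_oneHundredFortyNine_of_char_419 K
  · exact not_holdsInDegree_oneHundredFifty_of_char_419 K
  · exact not_holdsInDegree_oneHundredFiftyOne_of_char_419 K
  · exact not_holdsInDegree_oneHundredFiftyTwo_of_char_419 K
  · exact not_holdsInDegree_oneHundredFiftyThree_of_char_419 K
  · exact not_holdsInDegree_oneHundredFiftyFour_of_char_419 K
  · exact not_holdsInDegree_oneHundredFiftyFive_of_char_419 K
  · exact not_holdsInDegree_of_choose_modEq_one K 419 (d := 156) (m := 6) (by norm_num) (by norm_num) (by decide)
  · exact not_holdsInDegree_oneHundredFiftySeven_of_char_419 K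
  · exact not_holdsInDegree_oneHundredFiftyEight_of_char_419 K
  · exact not_holdsInDegree_oneHundredFiftyNine_of_char_419 K
  · exact not_holdsInDegree_oneHundredSixty_of_char_419 K
  · exact not_holdsInDegree_of_choose_modEq_one K 419 (d := 161) (m := 50) (by norm_num) (by norm_num) (by decide)
  · exact not_holdsInDegree_oneHundredSixtyTwo_of_char_419 K
  · exact not_holdsInDegree_oneHundredSixtyThree_of_char_419 K
  · exact not_holdsInDegree_oneHundredSixtyFour_of_char_419 K
  · exact not_holdsInDegree_oneHundredSixtyFive_of_char_419 K
  · exact not_holdsInDegree_oneHundredSixtySix_of_char_419 K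
  · exact not_holdsInDegree_oneHundredSixtySeven_of_char_419 K
  · exact not_holdsInDegree_oneHundredSixtyEight_of_char_419 K
  · exact not_holdsInDegree_oneHundredSixtyNine_of_char_419 K
  · exact not_holdsInDegree_of_choose_modEq_one K 419 (d := 170) (m := 9) (by norm_num) (by norm_num) (by decide)
  · exact not_holdsInDegree_of_choose_modEq_one K 419 (d := 171) (m := 68) (by norm_num) (by norm_num) (by decide)
  · exact not_holdsInDegree_of_choose_modEq_one K 419 (d := 172) (m := 29) (by norm_num) (by norm_num) (by decide)
  · exact not_holdsInDegree_of_choose_modEq_one K 419 (d := 173) (m := 39) (by norm_num) (by norm_num) (by decide)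
  · exact not_holdsInDegree_oneHundredSeventyFour_of_char_419 K
  · exact not_holdsInDegree_oneHundredSeventyFive_of_char_419 K
  · exact not_holdsInDegree_oneHundredSeventySix_of_char_419 K
  · exact not_holdsInDegree_oneHundredSeventySeven_of_char_419 K
  · exact not_holdsInDegree_oneHundredSeventyEight_of_char_419 K
  · exact not_holdsInDegree_oneHundredSeventyNine_of_char_419 K
  · exact not_holdsInDegree_oneHundredEighty_of_char_419 K
  · exact not_holdsInDegree_of_choose_modEq_one K 419 (d := 181) (m := 41) (by norm_num) (by norm_num) (by decide)
  · exact not_holdsInDegree_oneHundredEightyTwo_of_char_419 K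
  · exact not_holdsInDegree_of_choose_modEq_one K 419 (d := 183) (m := 6) (by norm_num) (by norm_num) (by decide)
  · exact not_holdsInDegree_oneHundredEightyFour_of_char_419 K
  · exact not_holdsInDegree_oneHundredEightyFive_of_char_419 K
  · exact not_holdsInDegree_oneHundredEightySix_of_char_419 K
  · exact not_holdsInDegree_oneHundredEightySeven_of_char_419 K
  · exact not_holdsInDegree_oneHundredEightyEight_of_char_419 K
  · exact not_holdsInDegree_oneHundredEightyNine_of_char_419 K
  · exact not_holdsInDegree_oneHundredNinety_of_char_419 K
  · exact not_holdsInDegree_oneHundredNinetyOne_of_char_419 K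
  · exact not_holdsInDegree_of_choose_modEq_one K 419 (d := 192) (m := 43) (by norm_num) (by norm_num) (by decide)
  · exact not_holdsInDegree_oneHundredNinetyThree_of_char_419 K
  · exact not_holdsInDegree_oneHundredNinetyFour_of_char_419 K
  · exact not_holdsInDegree_oneHundredNinetyFive_of_char_419 K
  · exact not_holdsInDegree_oneHundredNinetySix_of_char_419 K
  · exact not_holdsInDegree_oneHundredNinetySeven_of_char_419 K
  · exact not_holdsInDegree_oneHundredNinetyEight_of_char_419 K
  · exact not_holdsInDegree_oneHundredNinetyNine_of_char_419 K
  · exact not_holdsInDegree_twoHundred_of_char_419 K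
  · exact not_holdsInDegree_twoHundredOne_of_char_419 K
  · exact not_holdsInDegree_twoHundredTwo_of_char_419 K
  · exact not_holdsInDegree_twoHundredThree_of_char_419 K
  · exact not_holdsInDegree_twoHundredFour_of_char_419 K
  · exact not_holdsInDegree_of_choose_modEq_one K 419 (d := 205) (m := 82) (by norm_num) (by norm_num) (by decide)
  · exact not_holdsInDegree_twoHundredSix_of_char_419 K
  · exact not_holdsInDegree_of_choose_modEq_one K 419 (d := 207) (m := 53) (by norm_num) (by norm_num) (by decide)
  · exact not_holdsInDegree_twoHundredEight_of_char_419 K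
  · exact not_holdsInDegree_twoHundredNine_of_char_419 K
  · exact not_holdsInDegree_twoHundredTen_of_char_419 K
  · exact not_holdsInDegree_twoHundredEleven_of_char_419 K
  · exact not_holdsInDegree_twoHundredTwelve_of_char_419 K
  · exact not_holdsInDegree_twoHundredThirteen_of_char_419 K
  · exact not_holdsInDegree_twoHundredFourteen_of_char_419 K
  · exact not_holdsInDegree_of_choose_modEq_one K 419 (d := 215) (m := 37) (by norm_num) (by norm_num) (by decide)
  · exact not_holdsInDegree_of_choose_modEq_one K 419 (d := 216) (m := 77) (by norm_num) (by norm_num) (by decide)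
  · exact not_holdsInDegree_of_choose_modEq_one K 419 (d := 217) (m := 62) (by norm_num) (by norm_num) (by decide)
  · exact not_holdsInDegree_twoHundredEighteen_of_char_419 K
  · exact not_holdsInDegree_twoHundredNineteen_of_char_419 K
  · exact not_holdsInDegree_twoHundredTwenty_of_char_419 K
  · exact not_holdsInDegree_twoHundredTwentyOne_of_char_419 K
  · exact not_holdsInDegree_twoHundredTwentyTwo_of_char_419 K
  · exact not_holdsInDegree_twoHundredTwentyThree_of_char_419 K
  · exact not_holdsInDegree_twoHundredTwentyFour_of_char_419 K
  · exact not_holdsInDegree_twoHundredTwentyFive_of_char_419 K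
  · exact not_holdsInDegree_of_choose_modEq_one K 419 (d := 226) (m := 29) (by norm_num) (by norm_num) (by decide)
  · exact not_holdsInDegree_twoHundredTwentySeven_of_char_419 K
  · exact not_holdsInDegree_twoHundredTwentyEight_of_char_419 K
  · exact not_holdsInDegree_twoHundredTwentyNine_of_char_419 K
  · exact not_holdsInDegree_twoHundredThirty_of_char_419 K
  · exact not_holdsInDegree_twoHundredThirtyOne_of_char_419 K
  · exact not_holdsInDegree_of_choose_modEq_one K 419 (d := 232) (m := 55) (by norm_num) (by norm_num) (by decide)
  · exact not_holdsInDegree_twoHundredThirtyThree_of_char_419 K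
  · exact not_holdsInDegree_twoHundredThirtyFour_of_char_419 K
  · exact not_holdsInDegree_twoHundredThirtyFive_of_char_419 K
  · exact not_holdsInDegree_twoHundredThirtySix_of_char_419 K
  · exact not_holdsInDegree_twoHundredThirtySeven_of_char_419 K
  · exact not_holdsInDegree_twoHundredThirtyEight_of_char_419 K
  · exact not_holdsInDegree_of_choose_modEq_one K 419 (d := 239) (m := 76) (by norm_num) (by norm_num) (by decide)
  · exact not_holdsInDegree_twoHundredForty_of_char_419 K
  · exact not_holdsInDegree_of_choose_modEq_one K 419 (d := 241) (m := 6) (by norm_num) (by norm_num) (by decide)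
  · exact not_holdsInDegree_of_choose_modEq_one K 419 (d := 242) (m := 79) (by norm_num) (by norm_num) (by decide)
  · exact not_holdsInDegree_twoHundredFortyThree_of_char_419 K
  · exact not_holdsInDegree_twoHundredFortyFour_of_char_419 K
  · exact not_holdsInDegree_twoHundredFortyFive_of_char_419 K
  · exact not_holdsInDegree_twoHundredFortySix_of_char_419 K
  · exact not_holdsInDegree_of_choose_modEq_one K 419 (d := 247) (m := 41) (by norm_num) (by norm_num) (by decide)
  · exact not_holdsInDegree_twoHundredFortyEight_of_char_419 K
  · exact not_holdsInDegree_twoHundredFortyNine_of_char_419 K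
  · exact not_holdsInDegree_twoHundredFifty_of_char_419 K
  · exact not_holdsInDegree_twoHundredFiftyOne_of_char_419 K
  · exact not_holdsInDegree_twoHundredFiftyTwo_of_char_419 K
  · exact not_holdsInDegree_twoHundredFiftyThree_of_char_419 K
  · exact not_holdsInDegree_twoHundredFiftyFour_of_char_419 K
  · exact not_holdsInDegree_of_choose_modEq_one K 419 (d := 255) (m := 76) (by norm_num) (by norm_num) (by decide)
  · exact not_holdsInDegree_twoHundredFiftySix_of_char_419 K
  · exact not_holdsInDegree_twoHundredFiftySeven_of_char_419 K
  · exact not_holdsInDegree_twoHundredFiftyEight_of_char_419 K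
  · exact not_holdsInDegree_twoHundredFiftyNine_of_char_419 K
  · exact not_holdsInDegree_twoHundredSixty_of_char_419 K
  · exact not_holdsInDegree_twoHundredSixtyOne_of_char_419 K
  · exact not_holdsInDegree_twoHundredSixtyTwo_of_char_419 K
  · exact not_holdsInDegree_of_choose_modEq_one K 419 (d := 263) (m := 62) (by norm_num) (by norm_num) (by decide)
  · exact not_holdsInDegree_twoHundredSixtyFour_of_char_419 K
  · exact not_holdsInDegree_twoHundredSixtyFive_of_char_419 K
  · exact not_holdsInDegree_twoHundredSixtySix_of_char_419 K
  · exact not_holdsInDegree_twoHundredSixtySeven_of_char_419 K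
  · exact not_holdsInDegree_of_choose_modEq_one K 419 (d := 268) (m := 6) (by norm_num) (by norm_num) (by decide)
  · exact not_holdsInDegree_twoHundredSixtyNine_of_char_419 K
  · exact not_holdsInDegree_twoHundredSeventy_of_char_419 K
  · exact not_holdsInDegree_twoHundredSeventyOne_of_char_419 K
  · exact not_holdsInDegree_twoHundredSeventyTwo_of_char_419 K
  · exact not_holdsInDegree_twoHundredSeventyThree_of_char_419 K
  · exact not_holdsInDegree_of_choose_modEq_one K 419 (d := 274) (m := 129) (by norm_num) (by norm_num) (by decide)
  · exact not_holdsInDegree_twoHundredSeventyFive_of_char_419 K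
  · exact not_holdsInDegree_twoHundredSeventySix_of_char_419 K
  · exact not_holdsInDegree_of_choose_modEq_one K 419 (d := 277) (m := 35) (by norm_num) (by norm_num) (by decide)
  · exact not_holdsInDegree_of_choose_modEq_one K 419 (d := 278) (m := 33) (by norm_num) (by norm_num) (by decide)
  · exact not_holdsInDegree_twoHundredSeventyNine_of_char_419 K
  · exact not_holdsInDegree_twoHundredEighty_of_char_419 K
  · exact not_holdsInDegree_twoHundredEightyOne_of_char_419 K
  · exact not_holdsInDegree_twoHundredEightyTwo_of_char_419 K
  · exact not_holdsInDegree_twoHundredEightyThree_of_char_419 K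
  · exact not_holdsInDegree_twoHundredEightyFour_of_char_419 K
  · exact not_holdsInDegree_twoHundredEightyFive_of_char_419 K
  · exact not_holdsInDegree_twoHundredEightySix_of_char_419 K
  · exact not_holdsInDegree_twoHundredEightySeven_of_char_419 K
  · exact not_holdsInDegree_twoHundredEightyEight_of_char_419 K
  · exact not_holdsInDegree_of_choose_modEq_one K 419 (d := 289) (m := 47) (by norm_num) (by norm_num) (by decide)
  · exact not_holdsInDegree_twoHundredNinety_of_char_419 K
  · exact not_holdsInDegree_twoHundredNinetyOne_of_char_419 K
  · exact not_holdsInDegree_of_choose_modEq_one K 419 (d := 292) (m := 13) (by norm_num) (by norm_num) (by decide)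
  · exact not_holdsInDegree_of_choose_modEq_one K 419 (d := 293) (m := 56) (by norm_num) (by norm_num) (by decide)
  · exact not_holdsInDegree_twoHundredNinetyFour_of_char_419 K
  · exact not_holdsInDegree_of_choose_modEq_one K 419 (d := 295) (m := 82) (by norm_num) (by norm_num) (by decide)
  · exact not_holdsInDegree_twoHundredNinetySix_of_char_419 K
  · exact not_holdsInDegree_twoHundredNinetySeven_of_char_419 K
  · exact not_holdsInDegree_twoHundredNinetyEight_of_char_419 K
  · exact not_holdsInDegree_of_choose_modEq_one K 419 (d := 299) (m := 83) (by norm_num) (by norm_num) (by decide)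
  · exact not_holdsInDegree_threeHundred_of_char_419 K
  · exact not_holdsInDegree_of_choose_modEq_one K 419 (d := 301) (m := 105) (by norm_num) (by norm_num) (by decide)
  · exact not_holdsInDegree_threeHundredTwo_of_char_419 K
  · exact not_holdsInDegree_threeHundredThree_of_char_419 K
  · exact not_holdsInDegree_threeHundredFour_of_char_419 K
  · exact not_holdsInDegree_threeHundredFive_of_char_419 K
  · exact not_holdsInDegree_threeHundredSix_of_char_419 K
  · exact not_holdsInDegree_of_choose_modEq_one K 419 (d := 307) (m := 50) (by norm_num) (by norm_num) (by decide)
  · exact not_holdsInDegree_threeHundredEight_of_char_419 K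
  · exact not_holdsInDegree_threeHundredNine_of_char_419 K
  · exact not_holdsInDegree_of_choose_modEq_one K 419 (d := 310) (m := 85) (by norm_num) (by norm_num) (by decide)
  · exact not_holdsInDegree_threeHundredEleven_of_char_419 K
  · exact not_holdsInDegree_threeHundredTwelve_of_char_419 K
  · exact not_holdsInDegree_of_choose_modEq_one K 419 (d := 313) (m := 117) (by norm_num) (by norm_num) (by decide)
  · exact not_holdsInDegree_threeHundredFourteen_of_char_419 K
  · exact not_holdsInDegree_of_choose_modEq_one K 419 (d := 315) (m := 68) (by norm_num) (by norm_num) (by decide)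
  · exact not_holdsInDegree_threeHundredSixteen_of_char_419 K
  · exact not_holdsInDegree_threeHundredSeventeen_of_char_419 K
  · exact not_holdsInDegree_threeHundredEighteen_of_char_419 K
  · exact not_holdsInDegree_threeHundredNineteen_of_char_419 K
  · exact not_holdsInDegree_threeHundredTwenty_of_char_419 K
  · exact not_holdsInDegree_of_choose_modEq_one K 419 (d := 321) (m := 44) (by norm_num) (by norm_num) (by decide)
  · exact not_holdsInDegree_threeHundredTwentyTwo_of_char_419 K
  · exact not_holdsInDegree_of_choose_modEq_one K 419 (d := 323) (m := 3) (by norm_num) (by norm_num) (by decide)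
  · exact not_holdsInDegree_threeHundredTwentyFour_of_char_419 K
  · exact not_holdsInDegree_of_choose_modEq_one K 419 (d := 325) (m := 148) (by norm_num) (by norm_num) (by decide)
  · exact not_holdsInDegree_threeHundredTwentySix_of_char_419 K
  · exact not_holdsInDegree_threeHundredTwentySeven_of_char_419 K
  · exact not_holdsInDegree_threeHundredTwentyEight_of_char_419 K
  · exact not_holdsInDegree_threeHundredTwentyNine_of_char_419 K
  · exact not_holdsInDegree_threeHundredThirty_of_char_419 K
  · exact not_holdsInDegree_threeHundredThirtyOne_of_char_419 K
  · exact not_holdsInDegree_threeHundredThirtyTwo_of_char_419 K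
  · exact not_holdsInDegree_threeHundredThirtyThree_of_char_419 K
  · exact not_holdsInDegree_threeHundredThirtyFour_of_char_419 K
  · exact not_holdsInDegree_of_choose_modEq_one K 419 (d := 335) (m := 119) (by norm_num) (by norm_num) (by decide)
  · exact not_holdsInDegree_threeHundredThirtySix_of_char_419 K
  · exact not_holdsInDegree_threeHundredThirtySeven_of_char_419 K
  · exact not_holdsInDegree_threeHundredThirtyEight_of_char_419 K
  · exact not_holdsInDegree_threeHundredThirtyNine_of_char_419 K
  · exact not_holdsInDegree_of_choose_modEq_one K 419 (d := 340) (m := 9) (by norm_num) (by norm_num) (by decide)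
  · exact not_holdsInDegree_threeHundredFortyOne_of_char_419 K
  · exact not_holdsInDegree_threeHundredFortyTwo_of_char_419 K
  · exact not_holdsInDegree_threeHundredFortyThree_of_char_419 K
  · exact not_holdsInDegree_of_choose_modEq_one K 419 (d := 344) (m := 19) (by norm_num) (by norm_num) (by decide)
  · exact not_holdsInDegree_of_choose_modEq_one K 419 (d := 345) (m := 54) (by norm_num) (by norm_num) (by decide)
  · exact not_holdsInDegree_threeHundredFortySix_of_char_419 K
  · exact not_holdsInDegree_of_choose_modEq_one K 419 (d := 347) (m := 24) (by norm_num) (by norm_num) (by decide)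
  · exact not_holdsInDegree_threeHundredFortyEight_of_char_419 K
  · exact not_holdsInDegree_threeHundredFortyNine_of_char_419 K
  · exact not_holdsInDegree_threeHundredFifty_of_char_419 K
  · exact not_holdsInDegree_threeHundredFiftyOne_of_char_419 K
  · exact not_holdsInDegree_of_choose_modEq_one K 419 (d := 352) (m := 173) (by norm_num) (by norm_num) (by decide)
  · exact not_holdsInDegree_threeHundredFiftyThree_of_char_419 K
  · exact not_holdsInDegree_threeHundredFiftyFour_of_char_419 K
  · exact not_holdsInDegree_threeHundredFiftyFive_of_char_419 K
  · exact not_holdsInDegree_of_choose_modEq_one K 419 (d := 356) (m := 56) (by norm_num) (by norm_num) (by decide)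
  · exact not_holdsInDegree_of_choose_modEq_one K 419 (d := 357) (m := 82) (by norm_num) (by norm_num) (by decide)
  · exact not_holdsInDegree_threeHundredFiftyEight_of_char_419 K
  · exact not_holdsInDegree_threeHundredFiftyNine_of_char_419 K
  · exact not_holdsInDegree_threeHundredSixty_of_char_419 K
  · exact not_holdsInDegree_threeHundredSixtyOne_of_char_419 K
  · exact not_holdsInDegree_of_choose_modEq_one K 419 (d := 362) (m := 62) (by norm_num) (by norm_num) (by decide)
  · exact not_holdsInDegree_of_choose_modEq_one K 419 (d := 363) (m := 45) (by norm_num) (by norm_num) (by decide)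
  · exact not_holdsInDegree_threeHundredSixtyFour_of_char_419 K
  · exact not_holdsInDegree_of_choose_modEq_one K 419 (d := 365) (m := 154) (by norm_num) (by norm_num) (by decide)
  · exact not_holdsInDegree_threeHundredSixtySix_of_char_419 K
  · exact not_holdsInDegree_threeHundredSixtySeven_of_char_419 K
  · exact not_holdsInDegree_threeHundredSixtyEight_of_char_419 K
  · exact not_holdsInDegree_threeHundredSixtyNine_of_char_419 K
  · exact not_holdsInDegree_threeHundredSeventy_of_char_419 K
  · exact not_holdsInDegree_of_choose_modEq_one K 419 (d := 371) (m := 46) (by norm_num) (by norm_num) (by decide)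
  · exact not_holdsInDegree_threeHundredSeventyTwo_of_char_419 K
  · exact not_holdsInDegree_of_choose_modEq_one K 419 (d := 373) (m := 55) (by norm_num) (by norm_num) (by decide)
  · exact not_holdsInDegree_threeHundredSeventyFour_of_char_419 K
  · exact not_holdsInDegree_threeHundredSeventyFive_of_char_419 K
  · exact not_holdsInDegree_threeHundredSeventySix_of_char_419 K
  · exact not_holdsInDegree_of_choose_modEq_one K 419 (d := 377) (m := 140) (by norm_num) (by norm_num) (by decide)
  · exact not_holdsInDegree_threeHundredSeventyEight_of_char_419 K
  · exact not_holdsInDegree_of_choose_modEq_one K 419 (d := 379) (m := 134) (by norm_num) (by norm_num) (by decide)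
  · exact not_holdsInDegree_threeHundredEighty_of_char_419 K
  · exact not_holdsInDegree_of_choose_modEq_one K 419 (d := 381) (m := 178) (by norm_num) (by norm_num) (by decide)
  · exact not_holdsInDegree_threeHundredEightyTwo_of_char_419 K
  · exact not_holdsInDegree_of_choose_modEq_one K 419 (d := 383) (m := 141) (by norm_num) (by norm_num) (by decide)
  · exact not_holdsInDegree_threeHundredEightyFour_of_char_419 K
  · exact not_holdsInDegree_of_choose_modEq_one K 419 (d := 385) (m := 10) (by norm_num) (by norm_num) (by decide)
  · exact not_holdsInDegree_threeHundredEightySix_of_char_419 K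
  · exact not_holdsInDegree_threeHundredEightySeven_of_char_419 K
  · exact not_holdsInDegree_threeHundredEightyEight_of_char_419 K
  · exact not_holdsInDegree_of_choose_modEq_one K 419 (d := 389) (m := 17) (by norm_num) (by norm_num) (by decide)
  · exact not_holdsInDegree_threeHundredNinety_of_char_419 K
  · exact not_holdsInDegree_threeHundredNinetyOne_of_char_419 K
  · exact not_holdsInDegree_of_choose_modEq_one K 419 (d := 392) (m := 141) (by norm_num) (by norm_num) (by decide)
  · exact not_holdsInDegree_threeHundredNinetyThree_of_char_419 K
  · exact not_holdsInDegree_threeHundredNinetyFour_of_char_419 K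
  · exact not_holdsInDegree_of_choose_modEq_one K 419 (d := 395) (m := 84) (by norm_num) (by norm_num) (by decide)
  · exact not_holdsInDegree_threeHundredNinetySix_of_char_419 K
  · exact not_holdsInDegree_threeHundredNinetySeven_of_char_419 K
  · exact not_holdsInDegree_of_choose_modEq_one K 419 (d := 398) (m := 13) (by norm_num) (by norm_num) (by decide)
  · exact not_holdsInDegree_threeHundredNinetyNine_of_char_419 K
  · exact not_holdsInDegree_fourHundred_of_char_419 K
  · exact not_holdsInDegree_of_choose_modEq_one K 419 (d := 401) (m := 29) (by norm_num) (by norm_num) (by decide)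
  · exact not_holdsInDegree_of_choose_modEq_one K 419 (d := 402) (m := 65) (by norm_num) (by norm_num) (by decide)
  · exact not_holdsInDegree_fourHundredThree_of_char_419 K
  · exact not_holdsInDegree_fourHundredFour_of_char_419 K
  · exact not_holdsInDegree_of_choose_modEq_one K 419 (d := 405) (m := 122) (by norm_num) (by norm_num) (by decide)
  · exact not_holdsInDegree_fourHundredSix_of_char_419 K
  · exact not_holdsInDegree_fourHundredSeven_of_char_419 K
  · exact not_holdsInDegree_fourHundredEight_of_char_419 K
  · exact not_holdsInDegree_fourHundredNine_of_char_419 K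
  · exact not_holdsInDegree_fourHundredTen_of_char_419 K
  · exact not_holdsInDegree_fourHundredEleven_of_char_419 K
  · exact not_holdsInDegree_of_choose_modEq_one K 419 (d := 412) (m := 150) (by norm_num) (by norm_num) (by decide)
  · exact not_holdsInDegree_of_choose_modEq_one K 419 (d := 413) (m := 100) (by norm_num) (by norm_num) (by decide)
  · exact not_holdsInDegree_fourHundredFourteen_of_char_419 K
  · exact not_holdsInDegree_of_choose_modEq_one K 419 (d := 415) (m := 95) (by norm_num) (by norm_num) (by decide)
  · exact not_holdsInDegree_fourHundredSixteen_of_char_419 K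
  · exact not_holdsInDegree_fourHundredSeventeen_of_char_419 K
  · exact not_holdsInDegree_of_choose_modEq_one K 419 (d := 418) (m := 2) (by norm_num) (by norm_num) (by decide)

/-- the positive digits `1 ≤ a ≤ 5`: `CA_{a·419^k}` over every field of characteristic `419`. [cite: GrafVonBothmerEtAl2007, Props. 2, 6]
[cite: CastryckLaterveerOunaies2012, Thm. 4] -/
theorem holdsInDegree_mul_fourHundredNineteen_pow_of_le_five' {a : ℕ} (ha0 : 0 < a) (ha5 : a ≤ 5) (k : ℕ) :
    HoldsInDegree K (a * 419 ^ k) := by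
  haveI : Fact (Nat.Prime 419) := ⟨by norm_num⟩
  interval_cases a
  · simpa using holdsInDegree_prime_pow_field K 419 k
  · exact holdsInDegree_two_mul_prime_pow_field K 419 k
  · exact holdsInDegree_three_mul_prime_pow_field K 419 (by norm_num) k
  · exact holdsInDegree_mul_prime_pow_field K 419
      (holdsInDegree_of_le_four_of_charP (AlgebraicClosure K) 419 (by norm_num) le_rfl) k
  · exact holdsInDegree_five_mul_prime_pow_field K 419 (by norm_num) (by norm_num) (by norm_num) (by norm_num)
      (by norm_num) (by norm_num) (by norm_num) (by norm_num) (by norm_num) k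

/-- **characteristic 419, away from the digit `8`**: over every field of characteristic `419` and for every `d ≠ 8·419^k`,
`CA_d ⟺ d = 0 ∨ d = a·419^k` with `1 ≤ a ≤ 6`.  (The degrees `8·419^k` are excluded by hypothesis: no `𝔽_419`-rational-witness
Casas-Alvero octic exists, so the digit `8` is neither refuted nor certified here.) [cite: GrafVonBothmerEtAl2007, Props. 2, 6, 7]
[cite: CastryckLaterveerOunaies2012, Thm. 4] -/
theorem classification_char_fourHundredNineteen_partial (d : ℕ) (hd : ∀ k : ℕ, d ≠ 8 * 419 ^ k) :
    HoldsInDegree K d ↔ d = 0 ∨ ∃ k a : ℕ, 0 < a ∧ a ≤ 6 ∧ d = a * 419 ^ k := by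
  haveI : Fact (Nat.Prime 419) := ⟨by norm_num⟩
  constructor
  · intro h
    rcases Nat.eq_zero_or_pos d with rfl | hd0
    · exact Or.inl rfl
    obtain ⟨k, a, ha0, hap, rfl, ha⟩ := digit_of_holdsInDegree K 419 hd0.ne' h
    refine Or.inr ⟨k, a, ha0, ?_, rfl⟩
    by_contra hN
    rcases Nat.lt_or_ge a 7 with hlo | hlo
    · exact absurd (Nat.le_of_lt_succ hlo) hN
    · by_cases h8 : a = 8
      · subst h8
        exact hd k rfl
      · exact not_holdsInDegree_digit_of_char_fourHundredNineteen' K hlo hap h8 ha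
  · rintro (rfl | ⟨k, a, ha0, haN, rfl⟩)
    · exact holdsInDegree_zero K
    · rcases Nat.lt_or_ge a 6 with ha | ha
      · exact holdsInDegree_mul_fourHundredNineteen_pow_of_le_five' K ha0 (by omega) k
      · obtain rfl : a = 6 := le_antisymm haN ha
        exact holdsInDegree_six_mul_pow_of_char_419' K k

/-- **characteristic 419, complete GIVEN `CA_8`**: if the Casas-Alvero property holds over `K` in the degrees `8·419^k` (for instance once `419` is
certified a good prime of degree `8`, cf. the module docstring — nothing of the kind is proved in this tree), then `CA_d(K) ⟺ d = 0 ∨ d = a·419^k` with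
`a ∈ {{1, …, 6, 8}}` — a digit set that is NOT an initial segment. [cite: GrafVonBothmerEtAl2007, Props. 2, 6, 7] [cite: CastryckLaterveerOunaies2012, Thm. 4] -/
theorem classification_char_fourHundredNineteen_of_degree_eight (h8 : ∀ k : ℕ, HoldsInDegree K (8 * 419 ^ k)) (d : ℕ) :
    HoldsInDegree K d ↔ d = 0 ∨ ∃ k a : ℕ, 0 < a ∧ (a ≤ 6 ∨ a = 8) ∧ d = a * 419 ^ k := by
  haveI : Fact (Nat.Prime 419) := ⟨by norm_num⟩
  constructor
  · intro h
    rcases Nat.eq_zero_or_pos d with rfl | hd0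
    · exact Or.inl rfl
    obtain ⟨k, a, ha0, hap, rfl, ha⟩ := digit_of_holdsInDegree K 419 hd0.ne' h
    refine Or.inr ⟨k, a, ha0, ?_, rfl⟩
    by_contra hN
    rcases Nat.lt_or_ge a 7 with hlo | hlo
    · exact hN (Or.inl (by omega))
    · by_cases h8' : a = 8
      · exact hN (Or.inr h8')
      · exact not_holdsInDegree_digit_of_char_fourHundredNineteen' K hlo hap h8' ha
  · rintro (rfl | ⟨k, a, ha0, haN, rfl⟩)
    · exact holdsInDegree_zero K
    · rcases Nat.lt_or_ge a 6 with ha | ha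
      · exact holdsInDegree_mul_fourHundredNineteen_pow_of_le_five' K ha0 (by omega) k
      · rcases Nat.lt_or_ge a 7 with ha' | ha'
        · obtain rfl : a = 6 := by omega
          exact holdsInDegree_six_mul_pow_of_char_419' K k
        · obtain rfl : a = 8 := by rcases haN with h6 | h8e <;> omega
          exact h8 k

/-- **characteristic 419, complete GIVEN `¬CA_8`**: if the Casas-Alvero property FAILS over `K` in degree `8`, then (leading-digit reduction, forward half,
any field) it fails in every degree `8·419^k` and `CA_d(K) ⟺ d = 0 ∨ d = a·419^k` with `1 ≤ a ≤ 6`. [cite: GrafVonBothmerEtAl2007, Props. 2, 6, 7]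
[cite: CastryckLaterveerOunaies2012, Thm. 4] -/
theorem classification_char_fourHundredNineteen_of_not_degree_eight (h8 : ¬ HoldsInDegree K 8) (d : ℕ) :
    HoldsInDegree K d ↔ d = 0 ∨ ∃ k a : ℕ, 0 < a ∧ a ≤ 6 ∧ d = a * 419 ^ k := by
  haveI : Fact (Nat.Prime 419) := ⟨by norm_num⟩
  constructor
  · intro h
    rcases Nat.eq_zero_or_pos d with rfl | hd0
    · exact Or.inl rfl
    obtain ⟨k, a, ha0, hap, rfl, ha⟩ := digit_of_holdsInDegree K 419 hd0.ne' h
    refine Or.inr ⟨k, a, ha0, ?_, rfl⟩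
    by_contra hN
    rcases Nat.lt_or_ge a 7 with hlo | hlo
    · exact hN (by omega)
    · by_cases h8' : a = 8
      · subst h8'
        exact h8 ha
      · exact not_holdsInDegree_digit_of_char_fourHundredNineteen' K hlo hap h8' ha
  · rintro (rfl | ⟨k, a, ha0, haN, rfl⟩)
    · exact holdsInDegree_zero K
    · rcases Nat.lt_or_ge a 6 with ha | ha
      · exact holdsInDegree_mul_fourHundredNineteen_pow_of_le_five' K ha0 (by omega) k
      · obtain rfl : a = 6 := le_antisymm haN ha
        exact holdsInDegree_six_mul_pow_of_char_419' K k

/-- the set of Casas-Alvero degrees `≤ 175561` other than `8` and `8·419 = 3352` in characteristic `419`, explicitly (corollary of the classification away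
from the digit `8`: [cite: GrafVonBothmerEtAl2007, Prop. 6] with [cite: CastryckLaterveerOunaies2012, Thm. 4] and the digit refutations above). -/
theorem holdsInDegree_iff_mem_of_le_char_fourHundredNineteen_sq' {d : ℕ} (hd : d ≤ 175561) (h8 : d ≠ 8) (h8p : d ≠ 3352) :
    HoldsInDegree K d ↔ d ∈ ({0, 1, 2, 3, 4, 5, 6, 419, 838, 1257, 1676, 2095, 2514, 175561} : Finset ℕ) := by
  have hd' : ∀ k : ℕ, d ≠ 8 * 419 ^ k := by
    intro k
    rcases k with _ | _ | k
    · simpa using h8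
    · simpa using h8p
    · intro h
      have : 419 ^ 2 ≤ 419 ^ (k + 1 + 1) := Nat.pow_le_pow_right (by norm_num) (by omega)
      omega
  rw [classification_char_fourHundredNineteen_partial K d hd']
  constructor
  · rintro (rfl | ⟨k, a, ha0, haN, rfl⟩)
    · decide
    · rcases k with _ | _ | _ | k
      · interval_cases a <;> decide
      · interval_cases a <;> decide
      · interval_cases a <;> simp_all
      · exfalso
        have : 419 ^ 3 ≤ a * 419 ^ (k + 1 + 1 + 1) :=
          le_trans (Nat.pow_le_pow_right (by norm_num) (by omega)) (Nat.le_mul_of_pos_left _ ha0)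
        omega
  · intro h
    simp only [Finset.mem_insert, Finset.mem_singleton] at h
    rcases h with rfl | rfl | rfl | rfl | rfl | rfl | rfl | rfl | rfl | rfl | rfl | rfl | rfl | rfl
    · exact Or.inl rfl
    · exact Or.inr ⟨0, 1, by norm_num, by norm_num, by norm_num⟩
    · exact Or.inr ⟨0, 2, by norm_num, by norm_num, by norm_num⟩
    · exact Or.inr ⟨0, 3, by norm_num, by norm_num, by norm_num⟩
    · exact Or.inr ⟨0, 4, by norm_num, by norm_num, by norm_num⟩
    · exact Or.inr ⟨0, 5, by norm_num, by norm_num, by norm_num⟩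
    · exact Or.inr ⟨0, 6, by norm_num, by norm_num, by norm_num⟩
    · exact Or.inr ⟨1, 1, by norm_num, by norm_num, by norm_num⟩
    · exact Or.inr ⟨1, 2, by norm_num, by norm_num, by norm_num⟩
    · exact Or.inr ⟨1, 3, by norm_num, by norm_num, by norm_num⟩
    · exact Or.inr ⟨1, 4, by norm_num, by norm_num, by norm_num⟩
    · exact Or.inr ⟨1, 5, by norm_num, by norm_num, by norm_num⟩
    · exact Or.inr ⟨1, 6, by norm_num, by norm_num, by norm_num⟩
    · exact Or.inr ⟨2, 1, by norm_num, by norm_num, by norm_num⟩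

end CharFourHundredNineteenPartial

end Literature.Algebra.Polynomial.CasasAlvero
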